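import Summits.AnomalousDissipation.AnomalousDissipation.Theses.MomentParity
import Literature.Analysis.FluidPDE.CylindricalGenerator
import Literature.Analysis.FluidPDE.StatisticalSolutionEnergyEq
import Literature.Analysis.FluidPDE.NSGalerkinFourier
import Literature.Analysis.FunctionSpaces.TorusFluidGlueProofs
import Literature.Analysis.FunctionSpaces.TorusCalculusProofs
import Summits.AnomalousDissipation.AnomalousDissipation.Theorems.MomentParityQuarticGateBasis
import Summits.AnomalousDissipation.AnomalousDissipation.Theorems.CubicParityLoud.Negative.EnergyRow
import Summits.AnomalousDissipation.AnomalousDissipation.Theorems.MomentParityQuarticGateSignLemmaCalculus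

/-!
# Line `recession-cone` for the crux `MomentParity.QuarticGate` — stub S1, the SIGN LEMMA

Stub `stub_signLemma` of the registered skeleton `Cruxes/QuarticGate/Lines/recession-cone.lean`
(crux stmt-AnomalousDissipation-11464), statement copied byte-for-byte, plus its registered helper
`exists_frame_synthesis`. CLAIM: for a polynomial cylindrical observable `p(u) = P((u,g₁),…,(u,gₘ))`
with level-`N` band tests `gᵢ`, if the Galerkin–Euler derivative `{p,B_N}(u) = nsGeneratorPairing 0 0
u (∇p(u)) = −b(u,u,∇p(u))` is `≥ 0` at every level-`N` field `u ∈ H`, then it vanishes there.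
PROOF (Gaussian/Liouville sign lemma): in frame coordinates `c ∈ ℝ^A`, `A = Torus.FrameIdx (Fin 3) N`,
`e_a = Torus.frameFieldIdx N a` (Parseval frame of `V_N`, `MomentParityQuarticGateBasis`), synthesis
`U(c) = [∑ₐ cₐ e_a] ∈ H`: the pairings `(U c, gⱼ) = ∑_b c_b G j b` are linear, the rows
`Ẽ_a(c) = ⟨B_N(U c), e_a⟩ = ∑_{b,b'} c_b c_b' T a b b'` quadratic, and by the frame expansion of the
band tests `{p,B_N}(U c) = ∑ₐ ∂ₐp̂(c) Ẽ_a(c)` with `p̂(c) = P(G c)` (chain rule). The drift `Ẽ` is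
divergence free (`∂ₐẼ_a = ∑_b c_b (T a b a + T a a b) = 0`: `(e_a·∇)e_a = 0` and
`∫⟪e_a,(e_b·∇)e_a⟫ = 0`) and tangent to spheres (`∑ cₐ Ẽ_a = −b(u,u,u) = 0`), so
`sum_fderiv_mul_eq_zero_of_div_free` (`MomentParityQuarticGateSignLemmaCalculus`) gives
`{p,B_N}(U c) = 0`; and every level-`N` `u` has the same representative `∑ₐ (u,e_a) e_a` as `U(c(u))`
(`CubicParityLoud.Negative.fourierTruncate_ae_eq_of_isLevel`), which is all rows and pairings see.
-/

namespace Summit.AnomalousDissipation.AnomalousDissipation.Theorems.MomentParityQuarticGate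

open MeasureTheory Filter
open scoped InnerProductSpace RealInnerProductSpace
open Literature.Analysis.FunctionSpaces Literature.Analysis.FluidPDE
open Summit.AnomalousDissipation.AnomalousDissipation.Theses.MomentParity

set_option linter.dupNamespace false

namespace SignLemma

/-- **A single frame mode has no self-advection**: `(e·∇)e = 0` pointwise for `e = Re (e_k(x) z)`
with `k · z = 0` (a derivative of a function of `k·x` along a vector orthogonal to `k`). [folklore] -/
theorem convect_frameField_self {k : Fin 3 → ℤ} (hk : k ≠ 0) (j : Fin 3) (b : Bool)
    (x : UnitAddTorus (Fin 3)) :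
    Torus.convect (Torus.frameField k j b) (Torus.frameField k j b) x = 0 := by
  set z : EuclideanSpace ℂ (Fin 3) := Torus.frameVec k j b with hz
  have hsm : Torus.IsSmooth (Torus.frameField k j b) := Torus.isSmooth_realTrigPoly _ _
  have hcoord : ∀ i, Torus.frameField k j b x i = (UnitAddTorus.mFourier k x * z i).re := by
    intro i
    change Torus.realTrigPoly {k} (fun _ => z) x i = _
    rw [Torus.realTrigPoly_apply_coord, Torus.trigPoly_apply_coord, Finset.sum_singleton]
  -- the mode is orthogonal to `k`
  have hperp : ∑ i, Torus.frameField k j b x i * (k i : ℝ) = 0 := by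
    have h1 : ∑ i, Torus.frameField k j b x i * (k i : ℝ) =
        (UnitAddTorus.mFourier k x * ∑ i, (k i : ℂ) * z i).re := by
      rw [Finset.mul_sum, Complex.re_sum]
      refine Finset.sum_congr rfl fun i _ => ?_
      rw [hcoord, ← Complex.re_mul_ofReal, Complex.ofReal_intCast]
      ring_nf
    rw [h1, hz, Torus.sum_mul_frameVec hk j b, mul_zero, Complex.zero_re]
  -- expand the convective derivative in partial derivatives of the mode
  unfold Torus.convect
  rw [Torus.fderiv_apply_eq_sum_partialDeriv (hsm.isContDiff (by simp))]
  have hpd : ∀ i, Torus.partialDeriv i (Torus.frameField k j b) x =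
      EuclideanSpace.realPart (UnitAddTorus.mFourier k x •
        ((2 * Real.pi * Complex.I * (k i : ℂ)) • z)) := by
    intro i
    change Torus.partialDeriv i (Torus.realTrigPoly {k} (fun _ => z)) x = _
    rw [Torus.partialDeriv_realTrigPoly, Torus.realTrigPoly_singleton_apply]
  simp_rw [hpd]
  have hlin : ∀ i, Torus.frameField k j b x i • EuclideanSpace.realPart (UnitAddTorus.mFourier k x •
      ((2 * Real.pi * Complex.I * (k i : ℂ)) • z)) =
      EuclideanSpace.realPart (((Torus.frameField k j b x i : ℂ) * (UnitAddTorus.mFourier k x *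
        (2 * Real.pi * Complex.I * (k i : ℂ)))) • z) := by
    intro i
    rw [← map_smul, ← Complex.coe_smul, smul_smul, smul_smul, mul_assoc]
  simp_rw [hlin]
  rw [← map_sum, ← Finset.sum_smul]
  have hsum : ∑ i, (Torus.frameField k j b x i : ℂ) * (UnitAddTorus.mFourier k x *
      (2 * Real.pi * Complex.I * (k i : ℂ))) =
      UnitAddTorus.mFourier k x * (2 * Real.pi * Complex.I) *
        ((∑ i, Torus.frameField k j b x i * (k i : ℝ) : ℝ) : ℂ) := by
    rw [Complex.ofReal_sum, Finset.mul_sum]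
    refine Finset.sum_congr rfl fun i _ => ?_
    push_cast
    ring
  rw [hsum, hperp, Complex.ofReal_zero, mul_zero, zero_smul, map_zero]

/-- `∫ ⟪v, (u·∇)v⟫ = 0` for smooth solenoidal `u` and smooth `v` (`b(u,v,v) = 0`). [folklore] -/
theorem integral_inner_convect_eq_zero {u v : UnitAddTorus (Fin 3) → EuclideanSpace ℝ (Fin 3)}
    (hu : Torus.IsSmooth u) (hdiv : Torus.IsDivFree u) (hv : Torus.IsSmooth v) :
    ∫ x, ⟪v x, Torus.convect u v x⟫_ℝ = 0 := by
  have h := Torus.integral_inner_convect_add_eq_zero hu hdiv hv hv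
  have hsymm : ∫ x, ⟪Torus.convect u v x, v x⟫_ℝ = ∫ x, ⟪v x, Torus.convect u v x⟫_ℝ :=
    integral_congr_ae (ae_of_all _ fun x => real_inner_comm _ _)
  linarith

/-- **Frame reconstruction of a level-`N` field**: `u = ∑ₐ (u, e_a) e_a` a.e. for `u ∈ H` carried
by `0 < |k|² ≤ N²` (`P_N u = u` a.e. and the Parseval frame identity). [folklore] -/
theorem coe_ae_eq_sum_frame_of_level {N : ℕ} (u : Torus.energySpace (Fin 3))
    (hu : ∀ k ∉ (Torus.freqBall N).erase (0 : Fin 3 → ℤ),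
      UnitAddTorus.mFourierCoeff (EuclideanSpace.complexify ∘
        (u.1 : UnitAddTorus (Fin 3) → EuclideanSpace ℝ (Fin 3))) k = 0) :
    (u.1 : UnitAddTorus (Fin 3) → EuclideanSpace ℝ (Fin 3)) =ᵐ[volume]
      fun x => ∑ a : Torus.FrameIdx (Fin 3) N,
        Torus.pairing u.1 (Torus.frameFieldIdx N a) • Torus.frameFieldIdx N a x := by
  filter_upwards [CubicParityLoud.Negative.fourierTruncate_ae_eq_of_isLevel hu] with x hx
  rw [← fourierTruncate_eq_sum_frameFieldIdx N u x, hx]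

/-- **Frame reconstruction of a band test**, pointwise: a smooth solenoidal mean-zero field `g`
band limited to `0 < |k|² ≤ N²` satisfies `g = ∑ₐ (g, e_a) e_a` everywhere (a.e. by the frame
identity for `[g] ∈ H`, everywhere by continuity). [folklore] -/
theorem eq_sum_frame_of_bandTest {N : ℕ} {g : UnitAddTorus (Fin 3) → EuclideanSpace ℝ (Fin 3)}
    (hg : Torus.IsSmooth g ∧ Torus.IsDivFree g ∧ Torus.HasZeroMean g ∧
      ∀ k ∉ (Torus.freqBall N).erase (0 : Fin 3 → ℤ),
        UnitAddTorus.mFourierCoeff (EuclideanSpace.complexify ∘ g) k = 0)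
    (x : UnitAddTorus (Fin 3)) :
    g x = ∑ a : Torus.FrameIdx (Fin 3) N,
      (∫ y, ⟪g y, Torus.frameFieldIdx N a y⟫_ℝ) • Torus.frameFieldIdx N a x := by
  -- `[g] ∈ H` is a level-`N` field
  set v : Torus.energySpace (Fin 3) := ⟨(hg.1.memLp 2).toLp g,
    Torus.smoothSolenoidal_subset_energySpace ⟨g, hg.1, hg.2.1, hg.2.2.1, (hg.1.memLp 2).coeFn_toLp⟩⟩
  have hae : (v.1 : UnitAddTorus (Fin 3) → EuclideanSpace ℝ (Fin 3)) =ᵐ[volume] g :=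
    (hg.1.memLp 2).coeFn_toLp
  have hcoef : ∀ k, UnitAddTorus.mFourierCoeff (EuclideanSpace.complexify ∘
      (v.1 : UnitAddTorus (Fin 3) → EuclideanSpace ℝ (Fin 3))) k =
        UnitAddTorus.mFourierCoeff (EuclideanSpace.complexify ∘ g) k :=
    fun k => Torus.mFourierCoeff_congr_ae (hae.fun_comp EuclideanSpace.complexify) k
  have hv : ∀ k ∉ (Torus.freqBall N).erase (0 : Fin 3 → ℤ), UnitAddTorus.mFourierCoeff
      (EuclideanSpace.complexify ∘ (v.1 : UnitAddTorus (Fin 3) → EuclideanSpace ℝ (Fin 3))) k = 0 :=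
    fun k hk => (hcoef k).trans (hg.2.2.2 k hk)
  have hpair : ∀ a : Torus.FrameIdx (Fin 3) N,
      Torus.pairing v.1 (Torus.frameFieldIdx N a) = ∫ y, ⟪g y, Torus.frameFieldIdx N a y⟫_ℝ :=
    fun a => integral_congr_ae (hae.mono fun y hy => by simp only [hy])
  -- `g = P_N g = P_N v = v = ∑ (v, e_a) e_a` a.e., hence everywhere
  have hself : Torus.fourierTruncate N g = g :=
    Torus.fourierTruncate_eq_self hg.1.continuous fun k hk => hg.2.2.2 k fun hmem =>
      Torus.not_mem_freqBall.2 hk (Finset.mem_of_mem_erase hmem)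
  have htr : Torus.fourierTruncate N (v.1 : UnitAddTorus (Fin 3) → EuclideanSpace ℝ (Fin 3)) =
      Torus.fourierTruncate N g := by
    rw [Torus.fourierTruncate_eq, Torus.fourierTruncate_eq]
    exact Torus.realTrigPoly_congr fun k _ => hcoef k
  calc g x = Torus.fourierTruncate N (v.1 : UnitAddTorus (Fin 3) → EuclideanSpace ℝ (Fin 3)) x := by
        rw [htr, hself]
    _ = _ := fourierTruncate_eq_sum_frameFieldIdx N v x
    _ = _ := by simp_rw [hpair]

/-- **The Euler row through a representative**: if `U ∈ H` is represented by `w`, then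
`nsGeneratorPairing 0 0 U g = ∫ ⟪w, (w·∇)g⟫ = −b(w,w,g)` for smooth `g`
(`Torus.nsGeneratorPairing_eq_flux` with `ν = 0`, `f = 0`). [folklore] -/
theorem nsGeneratorPairing_zero_zero_eq_integral {U : Torus.energySpace (Fin 3)}
    {w : UnitAddTorus (Fin 3) → EuclideanSpace ℝ (Fin 3)}
    (hU : ((U.1 : Lp (EuclideanSpace ℝ (Fin 3)) 2 (volume : Measure (UnitAddTorus (Fin 3)))) :
      UnitAddTorus (Fin 3) → EuclideanSpace ℝ (Fin 3)) =ᵐ[volume] w)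
    {g : UnitAddTorus (Fin 3) → EuclideanSpace ℝ (Fin 3)} (hg : Torus.IsSmooth g) :
    Torus.nsGeneratorPairing (d := Fin 3) 0 0 U g = ∫ x, ⟪w x, Torus.convect w g x⟫_ℝ := by
  have h0 : MemLp (0 : UnitAddTorus (Fin 3) → EuclideanSpace ℝ (Fin 3)) 2 volume := MemLp.zero
  rw [Torus.nsGeneratorPairing_eq_flux (d := Fin 3) 0 h0 hg hU]
  refine integral_congr_ae (ae_of_all _ fun x => ?_)
  simp

/-- The pairing `(U, g)` through a representative of `U`. [folklore] -/
theorem pairing_eq_integral_of_ae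
    {U : Lp (EuclideanSpace ℝ (Fin 3)) 2 (volume : Measure (UnitAddTorus (Fin 3)))}
    {w : UnitAddTorus (Fin 3) → EuclideanSpace ℝ (Fin 3)}
    (hU : (U : UnitAddTorus (Fin 3) → EuclideanSpace ℝ (Fin 3)) =ᵐ[volume] w)
    (g : UnitAddTorus (Fin 3) → EuclideanSpace ℝ (Fin 3)) :
    Torus.pairing U g = ∫ x, ⟪w x, g x⟫_ℝ :=
  integral_congr_ae (hU.mono fun x hx => by simp only [hx])

/-- Pairing of a synthesis with a continuous field: `(∑ₐ cₐ e_a, g) = ∑ₐ cₐ (g, e_a)`. [folklore] -/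
theorem integral_inner_synthesis_left {ι : Type*} [Fintype ι] (c : ι → ℝ)
    {e : ι → UnitAddTorus (Fin 3) → EuclideanSpace ℝ (Fin 3)} (he : ∀ a, Continuous (e a))
    {g : UnitAddTorus (Fin 3) → EuclideanSpace ℝ (Fin 3)} (hg : Continuous g) :
    ∫ x, ⟪∑ a, c a • e a x, g x⟫_ℝ = ∑ a, c a * ∫ x, ⟪g x, e a x⟫_ℝ := by
  simp_rw [sum_inner, real_inner_smul_left]
  rw [integral_finsetSum _ fun a _ => (((he a).inner hg).integrable_unitAddTorus).const_mul (c a)]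
  refine Finset.sum_congr rfl fun a _ => ?_
  rw [integral_const_mul]
  exact congrArg _ (integral_congr_ae (ae_of_all _ fun x => real_inner_comm _ _))

/-- The convective pairing of a synthesis is a quadratic form in the coefficients:
`∫ ⟪∑ cₐe_a, ((∑ cₐe_a)·∇)g⟫ = ∑_b ∑_b' c_b c_b' ∫ ⟪e_b, (e_b'·∇)g⟫`. [folklore] -/
theorem integral_inner_synthesis_convect {ι : Type*} [Fintype ι] (c : ι → ℝ)
    {e : ι → UnitAddTorus (Fin 3) → EuclideanSpace ℝ (Fin 3)} (he : ∀ a, Torus.IsSmooth (e a))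
    {g : UnitAddTorus (Fin 3) → EuclideanSpace ℝ (Fin 3)} (hg : Torus.IsSmooth g) :
    ∫ x, ⟪∑ a, c a • e a x, Torus.convect (fun y => ∑ a, c a • e a y) g x⟫_ℝ =
      ∑ b, ∑ b', c b * c b' * ∫ x, ⟪e b x, Torus.convect (e b') g x⟫_ℝ := by
  have hpt : ∀ x, ⟪∑ a, c a • e a x, Torus.convect (fun y => ∑ a, c a • e a y) g x⟫_ℝ =
      ∑ b, ∑ b', c b * c b' * ⟪e b x, Torus.convect (e b') g x⟫_ℝ := fun x => by
    have hconv : Torus.convect (fun y => ∑ a, c a • e a y) g x =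
        ∑ b', c b' • Torus.convect (e b') g x := by
      simp only [Torus.convect, map_sum, map_smul]
    rw [hconv, sum_inner]
    refine Finset.sum_congr rfl fun b _ => ?_
    rw [inner_sum]
    refine Finset.sum_congr rfl fun b' _ => ?_
    rw [real_inner_smul_left, real_inner_smul_right, mul_assoc]
  have hint : ∀ b b', Integrable (fun x => c b * c b' * ⟪e b x, Torus.convect (e b') g x⟫_ℝ) volume :=
    fun b b' => (((he b).continuous.inner
      ((he b').convect hg).continuous).integrable_unitAddTorus).const_mul _
  simp_rw [hpt]
  rw [integral_finsetSum _ fun b _ => integrable_finsetSum _ fun b' _ => hint b b']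
  refine Finset.sum_congr rfl fun b _ => ?_
  rw [integral_finsetSum _ fun b' _ => hint b b']
  exact Finset.sum_congr rfl fun b' _ => integral_const_mul _ _

/-- **The differential of a polynomial observable lies in the frame span**: for band tests `gᵢ`,
`∑ᵢ κᵢ gᵢ = ∑ₐ (∑ᵢ κᵢ (gᵢ, e_a)) e_a` pointwise. [folklore] -/
theorem sum_smul_bandTest_eq_sum_frame {N m : ℕ}
    {g : Fin m → UnitAddTorus (Fin 3) → EuclideanSpace ℝ (Fin 3)}
    (hg : ∀ i, Torus.IsSmooth (g i) ∧ Torus.IsDivFree (g i) ∧ Torus.HasZeroMean (g i) ∧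
      ∀ k ∉ (Torus.freqBall N).erase (0 : Fin 3 → ℤ),
        UnitAddTorus.mFourierCoeff (EuclideanSpace.complexify ∘ (g i)) k = 0)
    (κ : Fin m → ℝ) (x : UnitAddTorus (Fin 3)) :
    ∑ i, κ i • g i x = ∑ a : Torus.FrameIdx (Fin 3) N,
      (∑ i, κ i * ∫ y, ⟪g i y, Torus.frameFieldIdx N a y⟫_ℝ) • Torus.frameFieldIdx N a x := by
  calc ∑ i, κ i • g i x
      = ∑ i, κ i • ∑ a : Torus.FrameIdx (Fin 3) N,
          (∫ y, ⟪g i y, Torus.frameFieldIdx N a y⟫_ℝ) • Torus.frameFieldIdx N a x :=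
        Finset.sum_congr rfl fun i _ => by rw [← eq_sum_frame_of_bandTest (hg i) x]
    _ = ∑ a : Torus.FrameIdx (Fin 3) N, ∑ i,
          (κ i * ∫ y, ⟪g i y, Torus.frameFieldIdx N a y⟫_ℝ) • Torus.frameFieldIdx N a x := by
        rw [Finset.sum_comm]
        simp only [Finset.smul_sum, smul_smul]
    _ = _ := Finset.sum_congr rfl fun a _ => by rw [Finset.sum_smul]

/-- **Chain rule for a polynomial observable in frame coordinates**: with the linear substitution
`yⱼ = ∑_b c_b G j b`, `c ↦ P(y(c))` is `C¹` and `∂_a P(y(c)) = ∑ᵢ (∂ᵢP)(y(c)) G i a`. [folklore] -/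
theorem fderiv_eval_linear {ι : Type} [Fintype ι] [DecidableEq ι] {m : ℕ} (G : Fin m → ι → ℝ)
    (P : MvPolynomial (Fin m) ℝ) :
    ContDiff ℝ 1 (fun c : ι → ℝ => MvPolynomial.eval (fun j => ∑ b, c b * G j b) P) ∧
      ∀ (c : ι → ℝ) (a : ι),
        fderiv ℝ (fun c : ι → ℝ => MvPolynomial.eval (fun j => ∑ b, c b * G j b) P) c (Pi.single a 1) =
          ∑ i, MvPolynomial.eval (fun j => ∑ b, c b * G j b) (MvPolynomial.pderiv i P) * G i a := by
  set Lc : (ι → ℝ) →L[ℝ] (Fin m → ℝ) :=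
    ContinuousLinearMap.pi fun j => ∑ b, G j b • ContinuousLinearMap.proj (R := ℝ) (φ := fun _ : ι => ℝ) b
    with hLc
  have hL : ∀ c : ι → ℝ, Lc c = fun j => ∑ b, c b * G j b := fun c => by
    ext j
    simp only [hLc, ContinuousLinearMap.pi_apply, sum_apply, smul_apply,
      ContinuousLinearMap.proj_apply, smul_eq_mul]
    exact Finset.sum_congr rfl fun b _ => mul_comm _ _
  have hfun : (fun c : ι → ℝ => MvPolynomial.eval (fun j => ∑ b, c b * G j b) P) =
      (fun y => MvPolynomial.eval y P) ∘ ⇑Lc := by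
    funext c
    simp only [Function.comp_apply, hL]
  refine ⟨?_, fun c a => ?_⟩
  · rw [hfun]
    exact (contDiff_mvPolynomial_eval P).comp Lc.contDiff
  · have h2 := (hasFDerivAt_mvPolynomial_eval P (Lc c)).comp c Lc.hasFDerivAt
    rw [hfun, h2.fderiv, ContinuousLinearMap.comp_apply, hL, sum_apply]
    refine Finset.sum_congr rfl fun i _ => ?_
    rw [smul_apply, ContinuousLinearMap.proj_apply, hL, smul_eq_mul]
    simp only [Pi.single_apply, ite_mul, one_mul, zero_mul, Finset.sum_ite_eq', Finset.mem_univ,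
      if_true]

/-- **Derivative of a coordinate quadratic form**: `Q(c) = ∑_b ∑_b' c_b c_b' T b b'` is `C¹` with
`∂_a Q(c) = ∑_b c_b T b a + ∑_b' c_b' T a b'`. [folklore] -/
theorem fderiv_quadratic {ι : Type} [Fintype ι] [DecidableEq ι] (T : ι → ι → ℝ) :
    ContDiff ℝ 1 (fun c : ι → ℝ => ∑ b, ∑ b', c b * c b' * T b b') ∧
      ∀ (c : ι → ℝ) (a : ι),
        fderiv ℝ (fun c : ι → ℝ => ∑ b, ∑ b', c b * c b' * T b b') c (Pi.single a 1) =
          ∑ b, c b * T b a + ∑ b', c b' * T a b' := by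
  refine ⟨ContDiff.sum fun b _ => ContDiff.sum fun b' _ =>
    ((contDiff_apply ℝ ℝ b).mul (contDiff_apply ℝ ℝ b')).mul contDiff_const, fun c a => ?_⟩
  have h : HasFDerivAt (fun c : ι → ℝ => ∑ b, ∑ b', c b * c b' * T b b')
      (∑ b, ∑ b', T b b' • (c b • ContinuousLinearMap.proj (R := ℝ) (φ := fun _ : ι => ℝ) b' +
        c b' • ContinuousLinearMap.proj (R := ℝ) (φ := fun _ : ι => ℝ) b)) c :=
    HasFDerivAt.fun_sum fun b _ => HasFDerivAt.fun_sum fun b' _ =>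
      ((hasFDerivAt_apply (𝕜 := ℝ) b c).mul (hasFDerivAt_apply (𝕜 := ℝ) b' c)).mul_const (T b b')
  rw [h.fderiv]
  simp only [sum_apply, smul_apply, add_apply, ContinuousLinearMap.proj_apply, Pi.single_apply,
    smul_eq_mul, mul_ite, mul_one, mul_zero, mul_add, Finset.sum_add_distrib, Finset.sum_ite_eq',
    Finset.mem_univ, if_true]
  congr 1
  · exact Finset.sum_congr rfl fun b _ => mul_comm _ _
  · rw [Finset.sum_comm]
    simp only [Finset.sum_ite_eq', Finset.mem_univ, if_true]
    exact Finset.sum_congr rfl fun b _ => mul_comm _ _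

end SignLemma

/-- **The synthesis map** `c ↦ U(c) = [∑ₐ cₐ e_a] ∈ H` (registered helper of S1): each `U(c)` is a
level-`N` element of `H` represented by the smooth field `∑ₐ cₐ e_a`. [folklore] -/
theorem exists_frame_synthesis :
    ∀ N : ℕ, ∃ U : (Torus.FrameIdx (Fin 3) N → ℝ) → Torus.energySpace (Fin 3), ∀ c,
      (((U c).1 : UnitAddTorus (Fin 3) → EuclideanSpace ℝ (Fin 3)) =ᵐ[volume]
          fun x => ∑ a, c a • Torus.frameFieldIdx N a x) ∧
        ∀ k ∉ (Torus.freqBall N).erase (0 : Fin 3 → ℤ),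
          UnitAddTorus.mFourierCoeff (EuclideanSpace.complexify ∘
            ((U c).1 : UnitAddTorus (Fin 3) → EuclideanSpace ℝ (Fin 3))) k = 0 := by
  intro N
  have hB := sum_smul_frameFieldIdx_band N
  have hmem : ∀ c : Torus.FrameIdx (Fin 3) N → ℝ,
      MemLp (fun x => ∑ a, c a • Torus.frameFieldIdx N a x) 2 volume := fun c => (hB c).1.memLp 2
  have hae : ∀ c : Torus.FrameIdx (Fin 3) N → ℝ,
      ((hmem c).toLp _ : UnitAddTorus (Fin 3) → EuclideanSpace ℝ (Fin 3)) =ᵐ[volume]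
        fun x => ∑ a, c a • Torus.frameFieldIdx N a x := fun c => MemLp.coeFn_toLp (hmem c)
  refine ⟨fun c => ⟨(hmem c).toLp _, Torus.smoothSolenoidal_subset_energySpace
    ⟨_, (hB c).1, (hB c).2.1, (hB c).2.2.1, hae c⟩⟩, fun c => ⟨hae c, fun k hk => ?_⟩⟩
  exact (Torus.mFourierCoeff_congr_ae ((hae c).fun_comp EuclideanSpace.complexify) k).trans
    ((hB c).2.2.2 k hk)

open SignLemma in
/-- **S1 — Gaussian/Liouville SIGN LEMMA.** A polynomial cylindrical observable
`p(u) = P((u,g₁),…,(u,gₘ))` with level-`N` band tests whose Galerkin–Euler derivative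
`{p,B_N}(u) = nsGeneratorPairing 0 0 u (∇p(u))` is `≥ 0` at every level-`N` field has
`{p,B_N} ≡ 0` on level-`N` fields. In frame coordinates `c ∈ ℝ^A` (`u = ∑ cₐ e_a`),
`{p,B_N} = ∇p̂ · Ẽ` with `Ẽ_a(c) = ⟨B_N(u), e_a⟩` a quadratic drift which is divergence free
(`(e_a·∇)e_a = 0` and `∫⟪e_a, (w·∇)e_a⟫ = 0`) and tangent to spheres (`∑ cₐ Ẽ_a = −b(u,u,u) = 0`);
the finite-dimensional sign lemma `signLemma_calculus` applies. [folklore] -/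
theorem stub_signLemma :
    ∀ (N m : ℕ) (g : Fin m → UnitAddTorus (Fin 3) → EuclideanSpace ℝ (Fin 3))
      (P : MvPolynomial (Fin m) ℝ),
      (∀ i, (Torus.IsSmooth (g i) ∧ Torus.IsDivFree (g i) ∧ Torus.HasZeroMean (g i) ∧
        ∀ k ∉ (Torus.freqBall N).erase (0 : Fin 3 → ℤ),
          UnitAddTorus.mFourierCoeff (EuclideanSpace.complexify ∘ (g i)) k = 0)) →
      (∀ u : Torus.energySpace (Fin 3), (∀ k ∉ (Torus.freqBall N).erase (0 : Fin 3 → ℤ),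
          UnitAddTorus.mFourierCoeff (EuclideanSpace.complexify ∘ (u.1 : UnitAddTorus (Fin 3) → EuclideanSpace ℝ (Fin 3))) k = 0) →
        0 ≤ Torus.nsGeneratorPairing (d := Fin 3) 0 0 u
          (fun x => ∑ i, (MvPolynomial.eval (fun j => Torus.pairing u.1 (g j))
            (MvPolynomial.pderiv i P)) • g i x)) →
      ∀ u : Torus.energySpace (Fin 3), (∀ k ∉ (Torus.freqBall N).erase (0 : Fin 3 → ℤ),
          UnitAddTorus.mFourierCoeff (EuclideanSpace.complexify ∘ (u.1 : UnitAddTorus (Fin 3) → EuclideanSpace ℝ (Fin 3))) k = 0) →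
        Torus.nsGeneratorPairing (d := Fin 3) 0 0 u
          (fun x => ∑ i, (MvPolynomial.eval (fun j => Torus.pairing u.1 (g j))
            (MvPolynomial.pderiv i P)) • g i x) = 0 := by
  intro N m g P hg hpos u hu
  classical
  -- the frame, the synthesis map, the coupling constants
  have he := frameFieldIdx_band N
  have hw := sum_smul_frameFieldIdx_band N
  obtain ⟨U, hU⟩ := exists_frame_synthesis N
  set e : Torus.FrameIdx (Fin 3) N → UnitAddTorus (Fin 3) → EuclideanSpace ℝ (Fin 3) :=
    Torus.frameFieldIdx N
  set G : Fin m → Torus.FrameIdx (Fin 3) N → ℝ := fun i a => ∫ y, ⟪g i y, e a y⟫_ℝ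
  set T : Torus.FrameIdx (Fin 3) N → Torus.FrameIdx (Fin 3) N → Torus.FrameIdx (Fin 3) N → ℝ :=
    fun a b b' => ∫ x, ⟪e b x, Torus.convect (e b') (e a) x⟫_ℝ with hT
  set h : (Torus.FrameIdx (Fin 3) N → ℝ) → ℝ :=
    fun c => MvPolynomial.eval (fun j => ∑ b, c b * G j b) P
  set V : Torus.FrameIdx (Fin 3) N → (Torus.FrameIdx (Fin 3) N → ℝ) → ℝ :=
    fun a c => ∑ b, ∑ b', c b * c b' * T a b b'
  -- (1) pairings and rows at the synthesis `U c`
  have hpair : ∀ c j, Torus.pairing (U c).1 (g j) = ∑ b, c b * G j b := fun c j => by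
    rw [pairing_eq_integral_of_ae (hU c).1,
      integral_inner_synthesis_left c (fun a => (he a).1.continuous) (hg j).1.continuous]
  have hrow : ∀ c a, Torus.nsGeneratorPairing (d := Fin 3) 0 0 (U c) (e a) = V a c := fun c a => by
    rw [nsGeneratorPairing_zero_zero_eq_integral (hU c).1 (he a).1]
    exact integral_inner_synthesis_convect c (fun a => (he a).1) (he a).1
  -- (2) the Euler derivative at `U c` is `∇h · V`
  have hkey : ∀ c, Torus.nsGeneratorPairing (d := Fin 3) 0 0 (U c)
      (fun x => ∑ i, (MvPolynomial.eval (fun j => Torus.pairing (U c).1 (g j))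
        (MvPolynomial.pderiv i P)) • g i x) = ∑ a, fderiv ℝ h c (Pi.single a 1) * V a c := by
    intro c
    have hp : (fun j => Torus.pairing (U c).1 (g j)) = fun j => ∑ b, c b * G j b := funext (hpair c)
    rw [hp, funext fun x => sum_smul_bandTest_eq_sum_frame hg _ x,
      Torus.nsGeneratorPairing_sum_smul 0 (integrable_zero _ _ _) (U c) Finset.univ _
        fun a _ => (he a).1]
    refine Finset.sum_congr rfl fun a _ => ?_
    rw [hrow, (fderiv_eval_linear G P).2 c a]
  -- (3) the drift is divergence free and tangent to spheres
  have hTself : ∀ a b, T a b a = 0 := fun a b => by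
    simp only [hT]
    refine (integral_congr_ae (ae_of_all _ fun x => ?_)).trans (integral_zero _ _)
    change ⟪e b x, Torus.convect (e a) (e a) x⟫_ℝ = (0 : ℝ)
    rw [show Torus.convect (e a) (e a) x = 0 from
      convect_frameField_self (Torus.ne_zero_of_mem_freqBall₀ a.1) a.2.1 a.2.2 x, inner_zero_right]
  have hTdiag : ∀ a b', T a a b' = 0 := fun a b' =>
    integral_inner_convect_eq_zero (he b').1 (he b').2.1 (he a).1
  have hdiv : ∀ c, ∑ a, fderiv ℝ (V a) c (Pi.single a 1) = 0 := fun c =>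
    Finset.sum_eq_zero fun a _ => by
      rw [(fderiv_quadratic (T a)).2 c a]
      simp only [hTself, hTdiag, mul_zero, Finset.sum_const_zero, add_zero]
  have htan : ∀ c : Torus.FrameIdx (Fin 3) N → ℝ, ∑ a, c a * V a c = 0 := fun c => by
    simp_rw [← hrow c]
    rw [← Torus.nsGeneratorPairing_sum_smul 0 (integrable_zero _ _ _) (U c) Finset.univ c
      fun a _ => (he a).1, nsGeneratorPairing_zero_zero_eq_integral (hU c).1 (hw c).1]
    exact integral_inner_convect_eq_zero (hw c).1 (hw c).2.1 (hw c).1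
  -- (4) the sign lemma in coordinates
  have hzero : ∀ c, ∑ a, fderiv ℝ h c (Pi.single a 1) * V a c = 0 :=
    sum_fderiv_mul_eq_zero_of_div_free (fderiv_eval_linear G P).1
      (fun a => (fderiv_quadratic (T a)).1) hdiv htan fun c => (hkey c) ▸ hpos (U c) (hU c).2
  -- (5) transport to `u`: `u` and `U c(u)` have the same representative `∑ (u, e_a) e_a`
  set cu : Torus.FrameIdx (Fin 3) N → ℝ := fun a => Torus.pairing u.1 (e a)
  have hu_ae := coe_ae_eq_sum_frame_of_level u hu
  have hp : (fun j => Torus.pairing u.1 (g j)) = fun j => Torus.pairing (U cu).1 (g j) := by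
    funext j
    rw [pairing_eq_integral_of_ae hu_ae, pairing_eq_integral_of_ae (hU cu).1]
  have hsm : Torus.IsSmooth (fun x => ∑ i, (MvPolynomial.eval (fun j => Torus.pairing (U cu).1 (g j))
      (MvPolynomial.pderiv i P)) • g i x) :=
    Torus.isSmooth_sum_smul Finset.univ _ fun i _ => (hg i).1
  rw [hp, nsGeneratorPairing_zero_zero_eq_integral hu_ae hsm,
    ← nsGeneratorPairing_zero_zero_eq_integral (hU cu).1 hsm, hkey cu]
  exact hzero cu

end Summit.AnomalousDissipation.AnomalousDissipation.Theorems.MomentParityQuarticGate
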